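import Summits.Ventures.CertifiedManyBodySolver.Certificates.HubbardTTPrime_polarizedBandCaps_kernelD
import Summits.Ventures.CertifiedManyBodySolver.Observables.PhaseSeparationExclusionFarCornerSliver
import Summits.Ventures.CertifiedManyBodySolver.Observables.PhaseSeparationExclusionFarOneYBCO
import Summits.Ventures.CertifiedManyBodySolver.Observables.PhaseSeparationExclusionFarPlanesBeyondHalf
import Summits.Ventures.CertifiedManyBodySolver.Observables.PhaseSeparationExclusionFarSevenEighthsYBCO
import Summits.Ventures.CertifiedManyBodySolver.Observables.PhaseSeparationExclusionTPrimeStripTwoFifths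
import HarnessLib
import HarnessLib.Audit

/-!
# Ventures/CertifiedManyBodySolver — Observables/PhaseSeparationExclusionFarSevenEighthsYBCOFifth.lean (COMPETING-ORDER words `(≤ 1/5 | ≥ 7/8)` on the FAR strip `t′ ∈ [−11/20, −3/10]` from the tranche-2 first-desk `n = 7/8` corner floors — POLARISED-CAP edition (kernel fully-polarised band caps, `U`-independent); sentence file 1 of 5)

HONEST FRAMING: first certified bounds; not a superconductivity verdict. CLASS = DERIVED / CONTEXT: instantiation of PROVED tree laws
(`ps_not_groundState_mix_on_cell_of_columns_tcap` / `ps_not_groundState_mix_above_column_tcap` of `Observables/PhaseSeparationExclusionTPrimeStripTwoFifths`,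
`fp_cap_r468_tcap_on_cell` of `…FarPlanes`, `columnLaw_carriedDown_U` of `…FarPlanesLowU`, `se78_virtual_floor_of_two` of `…SevenEighthsAnchorsLowU`,
`energyDensityTT'_tchord_floor_of_mem_Icc` / `floor_on_cell_of_tPrime_end_rows` of `…PhaseSeparationExclusionBox`, the kernel Hartree–Fock caps
`hfHalf_m55m50` / `hfHalf_m50m40` / `hfHalf_m40m30` / `hf5o8_m40m30` of `Certificates/HubbardTTPrime_hartreeFockCaps_kernel{,_m55m50}`) on CLAIM NODES BY NAME — the
REGISTRY `n = 7/8` corner floors of the cuprate-box programme on the FAR strip: tranche-2 FIRST-DESK corners #613 `(5, −11/20)` · #614 `(5, −2/5)` · #615 `(17/2, −2/5)` ·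
#616 `(17/2, −11/20)` (signed 2026-08-29, `cert_r61x_…` nodes of `Certificates/HubbardSquare_U{5,17o2}_n7o8_tpm{11o20,2o5}_lower_row61x`), the `U = 7/2` corners #554 ·
#555 · #590, and #551 · #561 · #591 · #595; the registry filling-`1/2` open-box witness plane r468 (`cert_r468_openbox_32x4_N64_planes`) where it is the cap — plus
PREMISE-FREE kernel Fermi-sea tangent rows at the dilute density and PROVED kernel Hartree–Fock caps. No new certificate, no CERTIFIED row, no cell word of the
meter's kind, no MOVE. Seat hubbard-box-p3 g33 (`prover-hubbard-box-p3-g33-0`, S2 «t′-direction transport from the anchors / joint concavity / box ⊂ union of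
certified cells ⇒ word»); generator `pub/hubbard-fast/hubbard-box-p3/work-g33/far78/emit_far78.py` (fork of g30's `emit78.py`; exact `fractions`; decimals =
10-place DOWNWARD roundings).

Companion of `PhaseSeparationExclusionFarSevenEighthsYBCO` (file 0: THE POINT, the virtual corners `fse78_vnode_…`, the `n = 7/8` column laws `fse78_col…` / `fse78_vcol…`, the carried-down
columns; round 2 cites the round-1 laws of `…FarSevenEighths` BY NAME and adds only the new virtual corners/columns). THIS FILE: the **`(≤ 1/5 | ≥ 7/8)`** sentence — no macroscopic ground-state mixture `λω₁ + (1−λ)ω₂` (`0 < λ < 1`) of translation-invariant states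
with densities `0 < ρ(ω₁) ≤ 1/5` and `7/8 ≤ ρ(ω₂) < 2`, at ANY filling in between (the dense member may carry any hole doping up to `1/8`, or be electron
doped), on the rectangles
* `t′ ∈ [-13 / 20, -3 / 5]` × `U ∈ [3, 100]` (`farSevenEighthsY_not_groundState_mix_le_1o5_ge_7o8_Y1`)
* `t′ ∈ [-3 / 5, -11 / 20]` × `U ∈ [3, 100]` (`farSevenEighthsY_not_groundState_mix_le_1o5_ge_7o8_Y2`)
(caps: the registry filling-`1/2` plane r468 BY NAME, or a PROVED kernel Hartree–Fock cap — `hfHalf_m55m50` / `hfHalf_m50m40` / `hfHalf_m40m30` (filling `1/2`),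
`hf5o8_m40m30` (filling `5/8`) — or (round 2) a PROVED kernel FULLY-POLARISED band cap `polHalf_…` / `pol5o8_…` (`Certificates/HubbardTTPrime_polarizedBandCaps_kernel{A,B,C}`, `U`-independent: every «above the top column» piece then holds for ALL larger `U`, stated up to `U = 100`) — whichever certifies the cell; lever arms `a = (7/8 − n_c)/(7/8 − 1/5)`, `b = (n_c − 1/5)/(7/8 − 1/5)`; dilute floors = landed
`t′`-chords of PREMISE-FREE kernel Fermi-sea tangent rows, cited BY NAME; every margin exact and positive, 10-dp DOWNWARD roundings in the docstrings).
WHAT THIS IS NOT: a certificate; a CERTIFIED row; a statement at `t′ > 0`, `T > 0`, or about stripes / which phase is realised / superconductivity; periodic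
(striped / Néel) COMPONENTS follow by the PROVED transfer law in the companion `…PeriodicPhasesFarSevenEighths`.
[cite: Israel1979, Thm. I.2.4] [cite: EmeryKivelsonLin1990, pp. 475–476] [cite: Ruelle1969, §3.3] [cite: Griffiths1966, §II] [cite: LiebLoss1993, §8, Theorem 8.2] [cite: BachLiebSolovej1994, eq. (2c.36)]
-/

noncomputable section

namespace Summit.Ventures.CertifiedManyBodySolver.Observables

open Summit.Ventures.CertifiedManyBodySolver.Certificates Summit.Ventures.CertifiedManyBodySolver.Downfold
open Literature.MathematicalPhysics.QuantumLattice Literature.MathematicalPhysics.QuantumLattice.ThermodynamicLimit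
open Literature.MathematicalPhysics.QuantumLattice.InfVolFermionState Set

/-! ## The `(≤ 1/5 | ≥ 7/8)` cells and rectangle words -/

/-- **`(≤ 1/5 | ≥ 7/8)` — segment Y1, columns `U ∈ [3, 17 / 2]`, `t′ ∈ [-13 / 20, -3 / 5]`** (cap filling `1 / 2`, weights `a, b = 5 / 9, 4 / 9`;
cap = the PROVED kernel FULLY-POLARISED band cap `polHalf_m65m60` (one spin species at density `1 / 2`, `U`-independent; no claim node);
`n = 7/8` column laws `fse78_col3_from7o2_m65m55` ∣ `fse78y_kin17o2_m65m55`; dilute floor `fp_dilute1o5_m65m60`; exact column margins (10-dp down) at `(s = -13 / 20 ∣ -3 / 5)`: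
`U = 3`: 0.0041507655 ∣ 0.0474527621; `U = 17 / 2`: 0.1588333828 ∣ 0.2021353794). [cite: Israel1979, Thm. I.2.4] [cite: EmeryKivelsonLin1990, pp. 475–476] [cite: Ruelle1969, §3.3] -/
theorem fse78y_1o5_Y11_columns (h554 : cert_r554_bs_GU7o2n7o8tpm11o20_w3_b4_R2_ob5p2_kry1_kry2c3rel_hanK7B4D4_KN4_PR20d4_uprime) (h616 : cert_r616_bs_GU17o2n7o8tpm11o20_w3_b4_R2_ob5p2_kry1_kry2c3rel_hanK7B4D4_KN4_PR20d4_uprime)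
    {s : ℝ} (hs : s ∈ Icc (-13 / 20 : ℝ) (-3 / 5 : ℝ)) {U : ℝ} (hU : U ∈ Icc (3 : ℝ) (17 / 2 : ℝ))
    {ω₁ ω₂ : InfVolFermionState 2} (h₁ : ω₁.IsTranslationInvariant) (h₂ : ω₂.IsTranslationInvariant)
    (hρ₁ : 0 < ω₁.density) (hρ₁' : ω₁.density ≤ (1 / 5)) (hρ₂ : 7 / 8 ≤ ω₂.density) (hρ₂' : ω₂.density < 2)
    {lam : ℝ} (hl0 : 0 < lam) (hl1 : lam < 1) :
    energyDensityTT' 1 s U (mix lam hl0.le hl1.le ω₁ ω₂).density <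
      (mix lam hl0.le hl1.le ω₁ ω₂).meanEnergy (hubbardTTPrimeFermionInteraction 1 s U) 1 := by
  refine ps_not_groundState_mix_on_cell_of_columns_tcap 1 (s₁ := -13 / 20) (s₂ := -3 / 5) (U₁ := 3) (U₂ := 17 / 2)
    (n₁ := (1 / 5)) (n₂ := 7 / 8) (a := 5 / 9) (b := 4 / 9) (by norm_num) (by norm_num) (by norm_num) (by norm_num)
    (by norm_num) (by norm_num) (by norm_num) (by norm_num)
    (polHalf_m65m60_tcap_on_cell (by norm_num) (by norm_num) (by norm_num) (by norm_num))
    (fun s hs => fse78_col3_from7o2_m65m55 h554 s ⟨hs.1.trans' (by norm_num), hs.2.trans (by norm_num)⟩)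
    (fun s hs => fse78y_kin17o2_m65m55 h616 s ⟨hs.1.trans' (by norm_num), hs.2.trans (by norm_num)⟩)
    (fun s hs U hU => fp_dilute1o5_m65m60 (n₁ := (1 / 5)) (by norm_num) (by norm_num) s ⟨hs.1.trans' (by norm_num), hs.2.trans (by norm_num)⟩ U (by linarith [hU.1]))
    ?_ ?_ hs hU h₁ h₂ hρ₁ hρ₁' hρ₂ hρ₂' hl0 hl1
  · intro s hs; obtain ⟨h1, h2⟩ := hs; push_cast; norm_num; nlinarith [h1, h2]
  · intro s hs; obtain ⟨h1, h2⟩ := hs; push_cast; norm_num; nlinarith [h1, h2]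

/-- **`(≤ 1/5 | ≥ 7/8)` — segment Y1 above the column `U = 17 / 2`: `t′ ∈ [-13 / 20, -3 / 5]`, `U ∈ [17 / 2, 100]`** (cap filling `1 / 2`, weights
`5 / 9, 4 / 9`; cap = the PROVED kernel FULLY-POLARISED band cap `polHalf_m65m60` (one spin species at density `1 / 2`, `U`-independent; no claim node); the `n = 7/8` column law `fse78y_kin17o2_m65m55` floors every larger `U`
[folklore: `energyDensityTT'_mono_U`]; the cap grows by `c₁ = 0.0000000` per unit `U`; margins at `U = 17 / 2`: 0.1588333828 ∣ 0.2021353794,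
at the far end `U = 100`: 0.1588333828 ∣ 0.2021353794). [cite: Israel1979, Thm. I.2.4] [cite: EmeryKivelsonLin1990, pp. 475–476] [cite: Ruelle1969, §3.3] -/
theorem fse78y_1o5_Y12_above (h616 : cert_r616_bs_GU17o2n7o8tpm11o20_w3_b4_R2_ob5p2_kry1_kry2c3rel_hanK7B4D4_KN4_PR20d4_uprime)
    {s : ℝ} (hs : s ∈ Icc (-13 / 20 : ℝ) (-3 / 5 : ℝ)) {U : ℝ} (hU : U ∈ Icc (17 / 2 : ℝ) (100 : ℝ))
    {ω₁ ω₂ : InfVolFermionState 2} (h₁ : ω₁.IsTranslationInvariant) (h₂ : ω₂.IsTranslationInvariant)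
    (hρ₁ : 0 < ω₁.density) (hρ₁' : ω₁.density ≤ (1 / 5)) (hρ₂ : 7 / 8 ≤ ω₂.density) (hρ₂' : ω₂.density < 2)
    {lam : ℝ} (hl0 : 0 < lam) (hl1 : lam < 1) :
    energyDensityTT' 1 s U (mix lam hl0.le hl1.le ω₁ ω₂).density <
      (mix lam hl0.le hl1.le ω₁ ω₂).meanEnergy (hubbardTTPrimeFermionInteraction 1 s U) 1 := by
  refine ps_not_groundState_mix_above_column_tcap 1 (s₁ := -13 / 20) (s₂ := -3 / 5) (U₂ := 17 / 2) (U₃ := 100)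
    (n₁ := (1 / 5)) (n₂ := 7 / 8) (a := 5 / 9) (b := 4 / 9) (by norm_num) (by norm_num) (by norm_num) (by norm_num)
    (by norm_num) (by norm_num) (by norm_num) (by norm_num)
    (polHalf_m65m60_tcap_on_cell (by norm_num) (by norm_num) (by norm_num) (by norm_num))
    (fun s hs => fse78y_kin17o2_m65m55 h616 s ⟨hs.1.trans' (by norm_num), hs.2.trans (by norm_num)⟩)
    (fun s hs U hU => fp_dilute1o5_m65m60 (n₁ := (1 / 5)) (by norm_num) (by norm_num) s ⟨hs.1.trans' (by norm_num), hs.2.trans (by norm_num)⟩ U (by linarith [hU.1]))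
    ?_ hs hU h₁ h₂ hρ₁ hρ₁' hρ₂ hρ₂' hl0 hl1
  intro s hs; obtain ⟨h1, h2⟩ := hs; push_cast; norm_num; nlinarith [h1, h2]

/-- **THE `(≤ 1/5 | ≥ 7/8)` SENTENCE ON `t′ ∈ [-13 / 20, -3 / 5] × U ∈ [3, 100]`** (segment Y1; union of 2 piece(s) in `U`). For every `(s, U)` of the
rectangle no mixture `λω₁ + (1−λ)ω₂` (`0 < λ < 1`) of translation-invariant states of the 2D `t–t′` Hubbard model at `(1, s, U)` with densities `0 < ρ(ω₁) ≤ 1/5` and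
`7/8 ≤ ρ(ω₂) < 2` is a ground state — at ANY filling in between: the hole-poor member may carry ANY hole doping up to `1/8` (or be electron doped). Conditional BY NAME on
the registry claim nodes in the signature (`n = 7/8` corner floors, and the r468 plane where it is the cap); kernel HF caps and dilute floors are premise-free. [cite: Israel1979, Thm. I.2.4] [cite: EmeryKivelsonLin1990, pp. 475–476] [cite: Ruelle1969, §3.3] -/
theorem farSevenEighthsY_not_groundState_mix_le_1o5_ge_7o8_Y1 (h554 : cert_r554_bs_GU7o2n7o8tpm11o20_w3_b4_R2_ob5p2_kry1_kry2c3rel_hanK7B4D4_KN4_PR20d4_uprime) (h616 : cert_r616_bs_GU17o2n7o8tpm11o20_w3_b4_R2_ob5p2_kry1_kry2c3rel_hanK7B4D4_KN4_PR20d4_uprime)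
    {s : ℝ} (hs : s ∈ Icc (-13 / 20 : ℝ) (-3 / 5 : ℝ)) {U : ℝ} (hU : U ∈ Icc (3 : ℝ) (100 : ℝ))
    {ω₁ ω₂ : InfVolFermionState 2} (h₁ : ω₁.IsTranslationInvariant) (h₂ : ω₂.IsTranslationInvariant)
    (hρ₁ : 0 < ω₁.density) (hρ₁' : ω₁.density ≤ (1 / 5)) (hρ₂ : 7 / 8 ≤ ω₂.density) (hρ₂' : ω₂.density < 2)
    {lam : ℝ} (hl0 : 0 < lam) (hl1 : lam < 1) :
    energyDensityTT' 1 s U (mix lam hl0.le hl1.le ω₁ ω₂).density <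
      (mix lam hl0.le hl1.le ω₁ ω₂).meanEnergy (hubbardTTPrimeFermionInteraction 1 s U) 1 := by
  rcases le_total U (17 / 2 : ℝ) with hu0 | hu0'
  · exact fse78y_1o5_Y11_columns h554 h616 hs ⟨hU.1, hu0⟩ h₁ h₂ hρ₁ hρ₁' hρ₂ hρ₂' hl0 hl1
  · exact fse78y_1o5_Y12_above h616 hs ⟨hu0', hU.2⟩ h₁ h₂ hρ₁ hρ₁' hρ₂ hρ₂' hl0 hl1

/-- **`(≤ 1/5 | ≥ 7/8)` — segment Y2, columns `U ∈ [3, 17 / 2]`, `t′ ∈ [-3 / 5, -11 / 20]`** (cap filling `1 / 2`, weights `a, b = 5 / 9, 4 / 9`;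
cap = the PROVED kernel FULLY-POLARISED band cap `polHalf_m60m55` (one spin species at density `1 / 2`, `U`-independent; no claim node);
`n = 7/8` column laws `fse78_col3_from7o2_m65m55` ∣ `fse78y_kin17o2_m65m55`; dilute floor `fcs_dilute1o5_m60m55`; exact column margins (10-dp down) at `(s = -3 / 5 ∣ -11 / 20)`:
`U = 3`: 0.0474527621 ∣ 0.0893626321; `U = 17 / 2`: 0.2021353794 ∣ 0.2440452494). [cite: Israel1979, Thm. I.2.4] [cite: EmeryKivelsonLin1990, pp. 475–476] [cite: Ruelle1969, §3.3] -/
theorem fse78y_1o5_Y21_columns (h554 : cert_r554_bs_GU7o2n7o8tpm11o20_w3_b4_R2_ob5p2_kry1_kry2c3rel_hanK7B4D4_KN4_PR20d4_uprime) (h616 : cert_r616_bs_GU17o2n7o8tpm11o20_w3_b4_R2_ob5p2_kry1_kry2c3rel_hanK7B4D4_KN4_PR20d4_uprime)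
    {s : ℝ} (hs : s ∈ Icc (-3 / 5 : ℝ) (-11 / 20 : ℝ)) {U : ℝ} (hU : U ∈ Icc (3 : ℝ) (17 / 2 : ℝ))
    {ω₁ ω₂ : InfVolFermionState 2} (h₁ : ω₁.IsTranslationInvariant) (h₂ : ω₂.IsTranslationInvariant)
    (hρ₁ : 0 < ω₁.density) (hρ₁' : ω₁.density ≤ (1 / 5)) (hρ₂ : 7 / 8 ≤ ω₂.density) (hρ₂' : ω₂.density < 2)
    {lam : ℝ} (hl0 : 0 < lam) (hl1 : lam < 1) :
    energyDensityTT' 1 s U (mix lam hl0.le hl1.le ω₁ ω₂).density <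
      (mix lam hl0.le hl1.le ω₁ ω₂).meanEnergy (hubbardTTPrimeFermionInteraction 1 s U) 1 := by
  refine ps_not_groundState_mix_on_cell_of_columns_tcap 1 (s₁ := -3 / 5) (s₂ := -11 / 20) (U₁ := 3) (U₂ := 17 / 2)
    (n₁ := (1 / 5)) (n₂ := 7 / 8) (a := 5 / 9) (b := 4 / 9) (by norm_num) (by norm_num) (by norm_num) (by norm_num)
    (by norm_num) (by norm_num) (by norm_num) (by norm_num)
    (polHalf_m60m55_tcap_on_cell (by norm_num) (by norm_num) (by norm_num) (by norm_num))
    (fun s hs => fse78_col3_from7o2_m65m55 h554 s ⟨hs.1.trans' (by norm_num), hs.2.trans (by norm_num)⟩)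
    (fun s hs => fse78y_kin17o2_m65m55 h616 s ⟨hs.1.trans' (by norm_num), hs.2.trans (by norm_num)⟩)
    (fun s hs U hU => fcs_dilute1o5_m60m55 (n₁ := (1 / 5)) (by norm_num) (by norm_num) s ⟨hs.1.trans' (by norm_num), hs.2.trans (by norm_num)⟩ U (by linarith [hU.1]))
    ?_ ?_ hs hU h₁ h₂ hρ₁ hρ₁' hρ₂ hρ₂' hl0 hl1
  · intro s hs; obtain ⟨h1, h2⟩ := hs; push_cast; norm_num; nlinarith [h1, h2]
  · intro s hs; obtain ⟨h1, h2⟩ := hs; push_cast; norm_num; nlinarith [h1, h2]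

/-- **`(≤ 1/5 | ≥ 7/8)` — segment Y2 above the column `U = 17 / 2`: `t′ ∈ [-3 / 5, -11 / 20]`, `U ∈ [17 / 2, 100]`** (cap filling `1 / 2`, weights
`5 / 9, 4 / 9`; cap = the PROVED kernel FULLY-POLARISED band cap `polHalf_m60m55` (one spin species at density `1 / 2`, `U`-independent; no claim node); the `n = 7/8` column law `fse78y_kin17o2_m65m55` floors every larger `U`
[folklore: `energyDensityTT'_mono_U`]; the cap grows by `c₁ = 0.0000000` per unit `U`; margins at `U = 17 / 2`: 0.2021353794 ∣ 0.2440452494,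
at the far end `U = 100`: 0.2021353794 ∣ 0.2440452494). [cite: Israel1979, Thm. I.2.4] [cite: EmeryKivelsonLin1990, pp. 475–476] [cite: Ruelle1969, §3.3] -/
theorem fse78y_1o5_Y22_above (h616 : cert_r616_bs_GU17o2n7o8tpm11o20_w3_b4_R2_ob5p2_kry1_kry2c3rel_hanK7B4D4_KN4_PR20d4_uprime)
    {s : ℝ} (hs : s ∈ Icc (-3 / 5 : ℝ) (-11 / 20 : ℝ)) {U : ℝ} (hU : U ∈ Icc (17 / 2 : ℝ) (100 : ℝ))
    {ω₁ ω₂ : InfVolFermionState 2} (h₁ : ω₁.IsTranslationInvariant) (h₂ : ω₂.IsTranslationInvariant)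
    (hρ₁ : 0 < ω₁.density) (hρ₁' : ω₁.density ≤ (1 / 5)) (hρ₂ : 7 / 8 ≤ ω₂.density) (hρ₂' : ω₂.density < 2)
    {lam : ℝ} (hl0 : 0 < lam) (hl1 : lam < 1) :
    energyDensityTT' 1 s U (mix lam hl0.le hl1.le ω₁ ω₂).density <
      (mix lam hl0.le hl1.le ω₁ ω₂).meanEnergy (hubbardTTPrimeFermionInteraction 1 s U) 1 := by
  refine ps_not_groundState_mix_above_column_tcap 1 (s₁ := -3 / 5) (s₂ := -11 / 20) (U₂ := 17 / 2) (U₃ := 100)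
    (n₁ := (1 / 5)) (n₂ := 7 / 8) (a := 5 / 9) (b := 4 / 9) (by norm_num) (by norm_num) (by norm_num) (by norm_num)
    (by norm_num) (by norm_num) (by norm_num) (by norm_num)
    (polHalf_m60m55_tcap_on_cell (by norm_num) (by norm_num) (by norm_num) (by norm_num))
    (fun s hs => fse78y_kin17o2_m65m55 h616 s ⟨hs.1.trans' (by norm_num), hs.2.trans (by norm_num)⟩)
    (fun s hs U hU => fcs_dilute1o5_m60m55 (n₁ := (1 / 5)) (by norm_num) (by norm_num) s ⟨hs.1.trans' (by norm_num), hs.2.trans (by norm_num)⟩ U (by linarith [hU.1]))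
    ?_ hs hU h₁ h₂ hρ₁ hρ₁' hρ₂ hρ₂' hl0 hl1
  intro s hs; obtain ⟨h1, h2⟩ := hs; push_cast; norm_num; nlinarith [h1, h2]

/-- **THE `(≤ 1/5 | ≥ 7/8)` SENTENCE ON `t′ ∈ [-3 / 5, -11 / 20] × U ∈ [3, 100]`** (segment Y2; union of 2 piece(s) in `U`). For every `(s, U)` of the
rectangle no mixture `λω₁ + (1−λ)ω₂` (`0 < λ < 1`) of translation-invariant states of the 2D `t–t′` Hubbard model at `(1, s, U)` with densities `0 < ρ(ω₁) ≤ 1/5` and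
`7/8 ≤ ρ(ω₂) < 2` is a ground state — at ANY filling in between: the hole-poor member may carry ANY hole doping up to `1/8` (or be electron doped). Conditional BY NAME on
the registry claim nodes in the signature (`n = 7/8` corner floors, and the r468 plane where it is the cap); kernel HF caps and dilute floors are premise-free. [cite: Israel1979, Thm. I.2.4] [cite: EmeryKivelsonLin1990, pp. 475–476] [cite: Ruelle1969, §3.3] -/
theorem farSevenEighthsY_not_groundState_mix_le_1o5_ge_7o8_Y2 (h554 : cert_r554_bs_GU7o2n7o8tpm11o20_w3_b4_R2_ob5p2_kry1_kry2c3rel_hanK7B4D4_KN4_PR20d4_uprime) (h616 : cert_r616_bs_GU17o2n7o8tpm11o20_w3_b4_R2_ob5p2_kry1_kry2c3rel_hanK7B4D4_KN4_PR20d4_uprime)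
    {s : ℝ} (hs : s ∈ Icc (-3 / 5 : ℝ) (-11 / 20 : ℝ)) {U : ℝ} (hU : U ∈ Icc (3 : ℝ) (100 : ℝ))
    {ω₁ ω₂ : InfVolFermionState 2} (h₁ : ω₁.IsTranslationInvariant) (h₂ : ω₂.IsTranslationInvariant)
    (hρ₁ : 0 < ω₁.density) (hρ₁' : ω₁.density ≤ (1 / 5)) (hρ₂ : 7 / 8 ≤ ω₂.density) (hρ₂' : ω₂.density < 2)
    {lam : ℝ} (hl0 : 0 < lam) (hl1 : lam < 1) :
    energyDensityTT' 1 s U (mix lam hl0.le hl1.le ω₁ ω₂).density <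
      (mix lam hl0.le hl1.le ω₁ ω₂).meanEnergy (hubbardTTPrimeFermionInteraction 1 s U) 1 := by
  rcases le_total U (17 / 2 : ℝ) with hu0 | hu0'
  · exact fse78y_1o5_Y21_columns h554 h616 hs ⟨hU.1, hu0⟩ h₁ h₂ hρ₁ hρ₁' hρ₂ hρ₂' hl0 hl1
  · exact fse78y_1o5_Y22_above h616 hs ⟨hu0', hU.2⟩ h₁ h₂ hρ₁ hρ₁' hρ₂ hρ₂' hl0 hl1

end Summit.Ventures.CertifiedManyBodySolver.Observables

end
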